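import Literature.AlgebraicGeometry.Motives.GrassmannianSchemeCharts
import Mathlib.AlgebraicGeometry.Cover.Open
import HarnessLib

/-!
# The standard open cover of the Grassmannian scheme by the chart schemes `Spec ℤ[X_I]` (object)

Topic `Literature/AlgebraicGeometry/Motives`; namespace `Literature.AlgebraicGeometry.Motives.Grassmannian`.  Sequel to `GrassmannianSchemeCharts`
(cell hodgecm-mathlib key (h4); B-p18 (g17)).  ONE DEFINITION (term-mode, statement-only lane) + `rfl` lemmas: the chart immersions
`Spec ℤ[X_I] ⟶ grassmannianScheme M k` (open immersions covering the scheme, ★ `isOpenImmersion_pointsEquiv_symm_chartElem`,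
★ `exists_mem_range_pointsEquiv_symm_chartElem`) packaged as a Mathlib `Scheme.OpenCover` — the input format of Mathlib's
«local at the source/target» machinery (finite type, smoothness, separatedness of the Grassmannian are then checked chart by chart).
[Stacks 089T]; [GortzWedhorn2020, (8.4), Cor. 8.15].  No instance / notation / `sorry`.
HC_CM is proved only modulo the 7 printed citations until rung 0 closes; nothing here is about HC.
-/

noncomputable section

namespace Literature.AlgebraicGeometry.Motives.Grassmannian

open CategoryTheory Opposite TensorProduct _root_.AlgebraicGeometry

universe u

variable (k : ℕ) (M : Type u) [AddCommGroup M] {J : Type u} (b : Module.Basis J ℤ M)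
variable [(grassmannianSheaf M k).obj.IsRepresentable]

/-- **The standard open cover of the Grassmannian scheme** by the affine spaces `Spec ℤ[X_I]`, `I : Fin k → J` injective, via the chart
immersions classified by the universal chart elements (Mathlib `Scheme.Cover.mkOfCovers`). [cite: StacksProject, Tag 089T]
[cite: GortzWedhorn2020, (8.4), Cor. 8.15] -/
def chartOpenCover : (grassmannianScheme M k).OpenCover :=
  Scheme.Cover.mkOfCovers {I : Fin k → J // Function.Injective I} (fun I => chartScheme k I.1)
    (fun I => (pointsEquiv M k (chartScheme k I.1)).symm (chartElem k M b I.1 I.2))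
    (exists_mem_range_pointsEquiv_symm_chartElem k M b)
    (fun I => isOpenImmersion_pointsEquiv_symm_chartElem k M b I.1 I.2)

/-- The members of the chart cover are the chart schemes `Spec ℤ[X_I]`. [cite: StacksProject, Tag 089T] -/
theorem chartOpenCover_X (I : {I : Fin k → J // Function.Injective I}) : (chartOpenCover k M b).X I = chartScheme k I.1 :=
  rfl

/-- The maps of the chart cover are the chart immersions. [cite: StacksProject, Tag 089T] -/
theorem chartOpenCover_f (I : {I : Fin k → J // Function.Injective I}) :
    (chartOpenCover k M b).f I = (pointsEquiv M k (chartScheme k I.1)).symm (chartElem k M b I.1 I.2) :=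
  rfl

end Literature.AlgebraicGeometry.Motives.Grassmannian

end
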